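import Literature.Computability.Complexity.ShenRefereeTokens
import Literature.Computability.Complexity.CodeFPLists
import Literature.Computability.Complexity.CodeFPStrings
import HarnessLib

/-!
# The `IP = PSPACE` referee, machine layer II: Arthur's rounds in polynomial time

Continuation of `ShenRefereeTokens.lean`. The round function of the referee specification
(`ShenRefereeSpec.lean`: `ShenRef.natRoundStep` — read Merlin's `d + 1` coefficients and Arthur's
challenge, evaluate `s(0)`, `s(1)`, `s(a)` by Horner mod `p`, check the operator of the round against the
claim, move the point) is computed on codes by the typed combinators of `CodeFP.lean`, and so is the
fold of the rounds over the move pairs (Arora–Barak §8.3.3: each step of the verifier is polynomial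
time; §1.3: polynomial time is closed under polynomially bounded loops):

* `ShenRef.hornerModC` (`CodeFP.foldl` over the reversed coefficient list; the accumulator is a residue),
  `blockC`, `coeffsOfC` (`CodeFP.map` over `[0, d]`), `opOfRoundC`, `checkNatC`;
* **`ShenRef.natRoundStepC`** — one round, and **`ShenRef.roundsC`** — all rounds from the initial
  state `natInit N` (the accumulator bound `length_stE_foldl_le`: the state is a round counter, `N`
  residues, a residue and a bit).

As in part I the modulus enters as `max q 2`, so that every bound holds on every input. All proved; no
named facts.

## References

* S. Arora, B. Barak, *Computational Complexity: A Modern Approach*, CUP 2009, §8.3.3 (the verifier's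
  checks), §1.3 (closure properties of polynomial time).
-/

noncomputable section

namespace Literature.Computability.Complexity

open _root_.Computability Polynomial Brick CodeFP Literature.Barriers.QuantumAdvantage

namespace ShenRef

/-! ### Horner evaluation on codes -/

/-- The Horner step `((q, r), (c, acc)) ↦ (c + r·acc) % max q 2`. [folklore] -/
theorem hornerStepC : CodeFP (pairE (pairE natE natE) (pairE natE natE)) natE
    (fun t : (ℕ × ℕ) × ℕ × ℕ => (t.2.1 + t.1.2 * t.2.2) % max t.1.1 2) := by
  have hq : CodeFP (pairE (pairE natE natE) (pairE natE natE)) natE (fun t : (ℕ × ℕ) × ℕ × ℕ => max t.1.1 2) :=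
    (natMax.comp ((fst _ _).fst'.pair (const _ 2)) :)
  have h1 : CodeFP (pairE (pairE natE natE) (pairE natE natE)) natE (fun t : (ℕ × ℕ) × ℕ × ℕ => t.1.2 * t.2.2) :=
    (natMul.comp ((fst _ _).snd'.pair (snd _ _).snd') :)
  have h2 : CodeFP (pairE (pairE natE natE) (pairE natE natE)) natE (fun t : (ℕ × ℕ) × ℕ × ℕ => t.2.1 + t.1.2 * t.2.2) :=
    (natAdd.comp ((snd _ _).fst'.pair h1) :)
  exact (natMod.comp (h2.pair hq) :)

/-- The Horner accumulator is a residue mod `max q 2` (or the initial `0`). [folklore] -/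
theorem foldl_hornerStep_lt (q r : ℕ) : ∀ (l : List ℕ) (acc : ℕ), acc < max q 2 →
    l.foldl (fun acc c => (c + r * acc) % max q 2) acc < max q 2
  | [], _, h => h
  | _ :: l, _, _ => foldl_hornerStep_lt q r l _ (Nat.mod_lt _ (lt_max_of_lt_right zero_lt_two))

/-- `|bin (max q 2)| ≤ |bin q| + 2`. [folklore] -/
theorem length_natE_max_two_le (q : ℕ) : (natE (max q 2)).length ≤ (natE q).length + 2 := by
  rw [length_natE, length_natE]
  rcases le_or_gt q 2 with h | h
  · rw [max_eq_right h]; exact (Nat.size_le.2 (by norm_num)).trans (Nat.le_add_left _ _)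
  · rw [max_eq_left h.le]; omega

/-- A number below `max q 2` has a short numeral. [folklore] -/
theorem length_natE_le_of_lt_max {q x : ℕ} (hx : x < max q 2) : (natE x).length ≤ (natE q).length + 2 :=
  le_trans (by rw [length_natE, length_natE]; exact size_mono hx.le) (length_natE_max_two_le q)

/-- **Horner evaluation on codes**: `((q, r), cs) ↦ hornerMod (max q 2) r cs`.
[cite: AroraBarakCC2009, §8.3.2 ("the verifier can evaluate … in polynomial time")] -/
theorem hornerModC : CodeFP (pairE (pairE natE natE) (rawE natE)) natE (fun t => hornerMod (max t.1.1 2) t.1.2 t.2) := by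
  have hfold : CodeFP (pairE (pairE natE natE) (rawE natE)) natE
      (fun p => p.2.foldl (fun acc c => (c + p.1.2 * acc) % max p.1.1 2) 0) := by
    refine foldl (σ := ℕ × ℕ) (α := ℕ) (β := ℕ) (eσ := pairE natE natE) (eα := natE) (eβ := natE)
      (step := fun s c acc => (c + s.2 * acc) % max s.1 2) (init := fun _ => 0) hornerStepC (const _ 0) (X + 2)
      fun s l₁ l₂ => ?_
    have hlt := foldl_hornerStep_lt s.1 s.2 l₁ 0 (lt_max_of_lt_right zero_lt_two)
    refine (length_natE_le_of_lt_max hlt).trans ?_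
    simp only [eval_add, eval_X, eval_ofNat, pairE_apply, length_boolPair]
    omega
  have hrev : CodeFP (pairE (pairE natE natE) (rawE natE)) (rawE natE) (fun t => t.2.reverse) := ((rawReverse natE).comp (snd _ _) :)
  exact ((hfold.comp ((fst _ _).pair hrev)).congr fun t => rfl :)

/-! ### Blocks and coefficients on codes -/

/-- **A block of a string on codes**: `(1^β, i, y) ↦ block β i y = (y.drop (iβ)).take β`. [folklore] -/
theorem blockC : CodeFP (pairE unE (pairE natE strE)) strE (fun t => block t.1 t.2.1 t.2.2) := by
  have hβ : CodeFP (pairE unE (pairE natE strE)) unE (fun t => t.1) := fst _ _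
  have hy : CodeFP (pairE unE (pairE natE strE)) strE (fun t => t.2.2) := (snd _ _).snd'
  have hprod : CodeFP (pairE unE (pairE natE strE)) natE (fun t => t.2.1 * t.1) := (natMul.comp ((snd _ _).fst'.pair (natOfUn.comp hβ)) :)
  have hamt : CodeFP (pairE unE (pairE natE strE)) unE (fun t => min (t.2.1 * t.1) t.2.2.length) :=
    (unOfNatMin.comp ((strLength.comp hy).pair hprod) :)
  have hdrop : CodeFP (pairE unE (pairE natE strE)) strE (fun t => t.2.2.drop (min (t.2.1 * t.1) t.2.2.length)) :=
    (strDrop.comp (hamt.pair hy) :)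
  have htake : CodeFP (pairE unE (pairE natE strE)) strE (fun t => (t.2.2.drop (min (t.2.1 * t.1) t.2.2.length)).take t.1) :=
    (strTake.comp (hβ.pair hdrop) :)
  exact htake.congr fun t => by
    -- dropping at least the whole list drops everything
    have hd : t.2.2.drop (min (t.2.1 * t.1) t.2.2.length) = t.2.2.drop (t.2.1 * t.1) := by
      rcases le_or_gt (t.2.1 * t.1) t.2.2.length with h | h
      · rw [min_eq_left h]
      · rw [min_eq_right h.le, List.drop_length, List.drop_eq_nil_of_le h.le]
    rw [hd]; rfl

/-- **Merlin's coefficients on codes**: `(q, 1^β, 1^d, y) ↦ coeffsOf (max q 2) β d y`. [cite: AroraBarakCC2009, §8.3.3] -/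
theorem coeffsOfC : CodeFP (pairE natE (pairE unE (pairE unE strE))) (rawE natE)
    (fun t => coeffsOf (max t.1 2) t.2.1 t.2.2.1 t.2.2.2) := by
  -- item map with context `(q, β, y)` over `i ∈ [0, d]`
  have hq : CodeFP (pairE (pairE natE (pairE unE strE)) natE) natE (fun u : (ℕ × ℕ × List Bool) × ℕ => max u.1.1 2) :=
    (natMax.comp ((fst _ _).fst'.pair (const _ 2)) :)
  have hblk : CodeFP (pairE (pairE natE (pairE unE strE)) natE) strE (fun u : (ℕ × ℕ × List Bool) × ℕ => block u.1.2.1 u.2 u.1.2.2) :=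
    (blockC.comp ((fst _ _).snd'.fst'.pair ((snd _ _).pair (fst _ _).snd'.snd')) :)
  have hitem : CodeFP (pairE (pairE natE (pairE unE strE)) natE) natE
      (fun u : (ℕ × ℕ × List Bool) × ℕ => bitsToNat (block u.1.2.1 u.2 u.1.2.2) % max u.1.1 2) :=
    (natMod.comp ((strVal.comp hblk).pair hq) :)
  have hmap := map (σ := ℕ × ℕ × List Bool) (α := ℕ) (eσ := pairE natE (pairE unE strE)) (eα := natE) (eβ := natE) hitem
  -- the context and the index list
  have hctx : CodeFP (pairE natE (pairE unE (pairE unE strE))) (pairE natE (pairE unE strE))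
      (fun t => (t.1, (t.2.1, t.2.2.2))) := ((fst _ _).pair ((snd _ _).fst'.pair (snd _ _).snd'.snd') :)
  have hidx : CodeFP (pairE natE (pairE unE (pairE unE strE))) (rawE natE) (fun t => List.range (t.2.2.1 + 1)) :=
    (urange.comp (unSucc.comp (snd _ _).snd'.fst') :)
  exact ((hmap.comp (hctx.pair hidx)).congr fun t => rfl :)

/-! ### The operator of a round on codes -/

/-- **`opOfRound` on codes**: `(quants, i) ↦ (kind, variable)`. [cite: AroraBarakCC2009, §8.3.3] -/
theorem opOfRoundC : CodeFP (pairE strE natE) (pairE natE natE) (fun t => opOfRound t.1 t.2) := by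
  have hN : CodeFP (pairE strE natE) natE (fun t => t.1.length) := (strNatLength.comp (fst _ _) :)
  have hi : CodeFP (pairE strE natE) natE (fun t => t.2) := snd _ _
  have hN1 : CodeFP (pairE strE natE) natE (fun t => t.1.length + 1) := (natAdd.comp (hN.pair (const _ 1)) :)
  have hM : CodeFP (pairE strE natE) natE (fun t => t.1.length * (t.1.length + 1)) := (natMul.comp (hN.pair hN1) :)
  have hc1 : CodeFP (pairE strE natE) bitE (fun t => decide (t.2 < t.1.length * (t.1.length + 1))) := (natLt.comp (hi.pair hM) :)
  have hb : CodeFP (pairE strE natE) natE (fun t => t.2 / (t.1.length + 1)) := (natDiv.comp (hi.pair hN1) :)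
  have ho : CodeFP (pairE strE natE) natE (fun t => t.2 % (t.1.length + 1)) := (natMod.comp (hi.pair hN1) :)
  have hc2 : CodeFP (pairE strE natE) bitE (fun t => t.2 % (t.1.length + 1) == 0) := ((beq natE_injective).comp (ho.pair (const _ 0)) :)
  have hqb : CodeFP (pairE strE natE) bitE (fun t => t.1.getD (t.2 / (t.1.length + 1)) false) := (strGetDNat.comp ((fst _ _).pair hb) :)
  have hkind : CodeFP (pairE strE natE) natE (fun t => if t.1.getD (t.2 / (t.1.length + 1)) false then 0 else 1) :=
    hqb.ite (const _ 0) (const _ 1)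
  have hA : CodeFP (pairE strE natE) (pairE natE natE)
      (fun t => (if t.1.getD (t.2 / (t.1.length + 1)) false then 0 else 1, t.2 / (t.1.length + 1))) := hkind.pair hb
  have hB : CodeFP (pairE strE natE) (pairE natE natE) (fun t => (2, t.2 % (t.1.length + 1) - 1)) :=
    ((const _ 2).pair (natSub.comp (ho.pair (const _ 1))) :)
  have hC : CodeFP (pairE strE natE) (pairE natE natE) (fun t => (2, t.2 - t.1.length * (t.1.length + 1))) :=
    ((const _ 2).pair (natSub.comp (hi.pair hM)) :)
  exact ((hc1.ite (hc2.ite hA hB) hC).congr fun t => rfl :)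

/-! ### The consistency check on codes -/

/-- **`checkNat` on codes**: `(q, kind, v_j, s(0), s(1)) ↦ checkNat q kind v_j s(0) s(1)` (the modulus as
given). [cite: AroraBarakCC2009, §8.3.3 (Cases 1–3)] -/
theorem checkNatC : CodeFP (pairE natE (pairE natE (pairE natE (pairE natE natE)))) natE
    (fun t => checkNat t.1 t.2.1 t.2.2.1 t.2.2.2.1 t.2.2.2.2) := by
  have hq : CodeFP (pairE natE (pairE natE (pairE natE (pairE natE natE)))) natE (fun t : ℕ × ℕ × ℕ × ℕ × ℕ => t.1) := fst _ _
  have hk : CodeFP (pairE natE (pairE natE (pairE natE (pairE natE natE)))) natE (fun t : ℕ × ℕ × ℕ × ℕ × ℕ => t.2.1) := (snd _ _).fst'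
  have hv : CodeFP (pairE natE (pairE natE (pairE natE (pairE natE natE)))) natE (fun t : ℕ × ℕ × ℕ × ℕ × ℕ => t.2.2.1) :=
    (snd _ _).snd'.fst'
  have h0 : CodeFP (pairE natE (pairE natE (pairE natE (pairE natE natE)))) natE (fun t : ℕ × ℕ × ℕ × ℕ × ℕ => t.2.2.2.1) :=
    (snd _ _).snd'.snd'.fst'
  have h1 : CodeFP (pairE natE (pairE natE (pairE natE (pairE natE natE)))) natE (fun t : ℕ × ℕ × ℕ × ℕ × ℕ => t.2.2.2.2) :=
    (snd _ _).snd'.snd'.snd'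
  -- `∀`: `s0 · s1 % q`
  have hall' : CodeFP (pairE natE (pairE natE (pairE natE (pairE natE natE)))) natE
      (fun t : ℕ × ℕ × ℕ × ℕ × ℕ => t.2.2.2.1 * t.2.2.2.2 % t.1) := (natMod.comp ((natMul.comp (h0.pair h1)).pair hq) :)
  -- `∃`: `disjVal q s0 s1`
  have hex' : CodeFP (pairE natE (pairE natE (pairE natE (pairE natE natE)))) natE
      (fun t : ℕ × ℕ × ℕ × ℕ × ℕ => disjVal t.1 t.2.2.2.1 t.2.2.2.2) := (disjValC.comp (hq.pair (h0.pair h1)) :)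
  -- `L`: `(oneSub q vj · s0 + vj · s1) % q`
  have hl1 : CodeFP (pairE natE (pairE natE (pairE natE (pairE natE natE)))) natE
      (fun t : ℕ × ℕ × ℕ × ℕ × ℕ => oneSub t.1 t.2.2.1 * t.2.2.2.1) := (natMul.comp ((oneSubC.comp (hq.pair hv)).pair h0) :)
  have hl2 : CodeFP (pairE natE (pairE natE (pairE natE (pairE natE natE)))) natE
      (fun t : ℕ × ℕ × ℕ × ℕ × ℕ => t.2.2.1 * t.2.2.2.2) := (natMul.comp (hv.pair h1) :)
  have hlin' : CodeFP (pairE natE (pairE natE (pairE natE (pairE natE natE)))) natE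
      (fun t : ℕ × ℕ × ℕ × ℕ × ℕ => (oneSub t.1 t.2.2.1 * t.2.2.2.1 + t.2.2.1 * t.2.2.2.2) % t.1) :=
    (natMod.comp ((natAdd.comp (hl1.pair hl2)).pair hq) :)
  have hk0 : CodeFP (pairE natE (pairE natE (pairE natE (pairE natE natE)))) bitE (fun t : ℕ × ℕ × ℕ × ℕ × ℕ => t.2.1 == 0) :=
    ((beq natE_injective).comp (hk.pair (const _ 0)) :)
  have hk1 : CodeFP (pairE natE (pairE natE (pairE natE (pairE natE natE)))) bitE (fun t : ℕ × ℕ × ℕ × ℕ × ℕ => t.2.1 == 1) :=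
    ((beq natE_injective).comp (hk.pair (const _ 1)) :)
  exact ((hk0.ite hall' (hk1.ite hex' hlin')).congr fun t => rfl :)

/-! ### One round on codes -/

/-- The context of the rounds: modulus, prefix, block width, degree bound. [folklore] -/
abbrev RCtx : Type := ℕ × List Bool × ℕ × ℕ

/-- Code of the round context (`β`, `d` in unary). [folklore] -/
abbrev rctxE : RCtx → List Bool := pairE natE (pairE strE (pairE unE unE))

/-- Code of Arthur's state over `ℕ`. [folklore] -/
abbrev stE : NSt → List Bool := pairE natE (pairE (rawE natE) (pairE natE bitE))

/-- The tuple handed to the round step on codes: context, move pair, state. [folklore] -/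
abbrev RdT : Type := RCtx × (List Bool × List Bool) × NSt

/-- Code of the round tuple. [folklore] -/
abbrev rdE : RdT → List Bool := pairE rctxE (pairE (pairE strE strE) stE)

/-- The raw modulus. [folklore] -/
theorem rdQraw : CodeFP rdE natE (fun t : RdT => t.1.1) := (fst _ _).fst'
/-- The modulus `max q 2`. [folklore] -/
theorem rdQ : CodeFP rdE natE (fun t : RdT => max t.1.1 2) := (natMax.comp (rdQraw.pair (const _ 2)) :)
/-- The prefix. [folklore] -/
theorem rdQuants : CodeFP rdE strE (fun t : RdT => t.1.2.1) := (fst _ _).snd'.fst'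
/-- The block width. [folklore] -/
theorem rdBeta : CodeFP rdE unE (fun t : RdT => t.1.2.2.1) := (fst _ _).snd'.snd'.fst'
/-- The degree bound. [folklore] -/
theorem rdD : CodeFP rdE unE (fun t : RdT => t.1.2.2.2) := (fst _ _).snd'.snd'.snd'
/-- Merlin's move. [folklore] -/
theorem rdY : CodeFP rdE strE (fun t : RdT => t.2.1.1) := (snd _ _).fst'.fst'
/-- Arthur's move. [folklore] -/
theorem rdZ : CodeFP rdE strE (fun t : RdT => t.2.1.2) := (snd _ _).fst'.snd'
/-- The state. [folklore] -/
theorem rdSt : CodeFP rdE stE (fun t : RdT => t.2.2) := (snd _ _).snd'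
/-- The round counter. [folklore] -/
theorem rdI : CodeFP rdE natE (fun t : RdT => t.2.2.1) := rdSt.fst'
/-- The point. [folklore] -/
theorem rdVals : CodeFP rdE (rawE natE) (fun t : RdT => t.2.2.2.1) := rdSt.snd'.fst'
/-- The claim. [folklore] -/
theorem rdC : CodeFP rdE natE (fun t : RdT => t.2.2.2.2.1) := rdSt.snd'.snd'.fst'
/-- The flag. [folklore] -/
theorem rdOk : CodeFP rdE bitE (fun t : RdT => t.2.2.2.2.2) := rdSt.snd'.snd'.snd'

/-- The number of rounds `T = N(N+1) + N`, on codes. [folklore] -/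
theorem rdT : CodeFP rdE natE (fun t : RdT => t.1.2.1.length * (t.1.2.1.length + 1) + t.1.2.1.length) := by
  have hN : CodeFP rdE natE (fun t : RdT => t.1.2.1.length) := (strNatLength.comp rdQuants :)
  have hN1 : CodeFP rdE natE (fun t : RdT => t.1.2.1.length + 1) := (natAdd.comp (hN.pair (const _ 1)) :)
  have hM : CodeFP rdE natE (fun t : RdT => t.1.2.1.length * (t.1.2.1.length + 1)) := (natMul.comp (hN.pair hN1) :)
  exact (natAdd.comp (hM.pair hN) :)

/-- The operator of the round, on codes. [folklore] -/
theorem rdOp : CodeFP rdE (pairE natE natE) (fun t : RdT => opOfRound t.1.2.1 t.2.2.1) := (opOfRoundC.comp (rdQuants.pair rdI) :)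

/-- Arthur's challenge `a = (z as a number) % max q 2`, on codes. [folklore] -/
theorem rdR : CodeFP rdE natE (fun t : RdT => bitsToNat t.2.1.2 % max t.1.1 2) := (natMod.comp ((strVal.comp rdZ).pair rdQ) :)

/-- Merlin's coefficients, on codes. [folklore] -/
theorem rdCs : CodeFP rdE (rawE natE) (fun t : RdT => coeffsOf (max t.1.1 2) t.1.2.2.1 t.1.2.2.2 t.2.1.1) :=
  (coeffsOfC.comp (rdQraw.pair (rdBeta.pair (rdD.pair rdY))) :)

/-- `s(g)` for a computed argument `g`, on codes. [folklore] -/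
theorem rdHorner {g : RdT → ℕ} (hg : CodeFP rdE natE g) :
    CodeFP rdE natE (fun t : RdT => hornerMod (max t.1.1 2) (g t) (coeffsOf (max t.1.1 2) t.1.2.2.1 t.1.2.2.2 t.2.1.1)) :=
  (hornerModC.comp ((rdQraw.pair hg).pair rdCs) :)

/-- The check of the round, on codes. [folklore] -/
theorem rdCheck : CodeFP rdE natE (fun t : RdT =>
    checkNat (max t.1.1 2) (opOfRound t.1.2.1 t.2.2.1).1 (t.2.2.2.1.getD (opOfRound t.1.2.1 t.2.2.1).2 0)
      (hornerMod (max t.1.1 2) 0 (coeffsOf (max t.1.1 2) t.1.2.2.1 t.1.2.2.2 t.2.1.1))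
      (hornerMod (max t.1.1 2) 1 (coeffsOf (max t.1.1 2) t.1.2.2.1 t.1.2.2.2 t.2.1.1))) := by
  have hvj : CodeFP rdE natE (fun t : RdT => t.2.2.2.1.getD (opOfRound t.1.2.1 t.2.2.1).2 0) :=
    ((rawGetD natE (d := (0 : ℕ)) rfl).comp (rdVals.pair rdOp.snd') :)
  have hs0 := rdHorner (const _ (0 : ℕ))
  have hs1 := rdHorner (const _ (1 : ℕ))
  exact (checkNatC.comp (rdQ.pair (rdOp.fst'.pair (hvj.pair (hs0.pair hs1)))) :)

/-- **One round on codes**: `((q, quants, 1^β, 1^d), ((y, z), st)) ↦ natRoundStep (max q 2) β d quants st (y, z)`.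
[cite: AroraBarakCC2009, §8.3.3 (one step of the verifier)] -/
theorem natRoundStepC : CodeFP rdE stE (fun t : RdT => natRoundStep (max t.1.1 2) t.1.2.2.1 t.1.2.2.2 t.1.2.1 t.2.2 t.2.1) := by
  have hcond : CodeFP rdE bitE (fun t : RdT => decide (t.1.2.1.length * (t.1.2.1.length + 1) + t.1.2.1.length ≤ t.2.2.1)) :=
    (natLe.comp (rdT.pair rdI) :)
  have hi1 : CodeFP rdE natE (fun t : RdT => t.2.2.1 + 1) := (natAdd.comp (rdI.pair (const _ 1)) :)
  have hvals : CodeFP rdE (rawE natE) (fun t : RdT => t.2.2.2.1.set (opOfRound t.1.2.1 t.2.2.1).2 (bitsToNat t.2.1.2 % max t.1.1 2)) :=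
    ((setAt natE).comp (rdVals.pair (rdOp.snd'.pair rdR)) :)
  have hsr := rdHorner rdR
  have hok : CodeFP rdE bitE (fun t : RdT => t.2.2.2.2.2 &&
      (checkNat (max t.1.1 2) (opOfRound t.1.2.1 t.2.2.1).1 (t.2.2.2.1.getD (opOfRound t.1.2.1 t.2.2.1).2 0)
        (hornerMod (max t.1.1 2) 0 (coeffsOf (max t.1.1 2) t.1.2.2.1 t.1.2.2.2 t.2.1.1))
        (hornerMod (max t.1.1 2) 1 (coeffsOf (max t.1.1 2) t.1.2.2.1 t.1.2.2.2 t.2.1.1)) == t.2.2.2.2.1)) :=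
    rdOk.and ((beq natE_injective).comp (rdCheck.pair rdC) :)
  have hnew : CodeFP rdE stE (fun t : RdT =>
      (t.2.2.1 + 1, t.2.2.2.1.set (opOfRound t.1.2.1 t.2.2.1).2 (bitsToNat t.2.1.2 % max t.1.1 2),
        hornerMod (max t.1.1 2) (bitsToNat t.2.1.2 % max t.1.1 2) (coeffsOf (max t.1.1 2) t.1.2.2.1 t.1.2.2.2 t.2.1.1),
        (t.2.2.2.2.2 &&
          (checkNat (max t.1.1 2) (opOfRound t.1.2.1 t.2.2.1).1 (t.2.2.2.1.getD (opOfRound t.1.2.1 t.2.2.1).2 0)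
            (hornerMod (max t.1.1 2) 0 (coeffsOf (max t.1.1 2) t.1.2.2.1 t.1.2.2.2 t.2.1.1))
            (hornerMod (max t.1.1 2) 1 (coeffsOf (max t.1.1 2) t.1.2.2.1 t.1.2.2.2 t.2.1.1)) == t.2.2.2.2.1)))) :=
    hi1.pair (hvals.pair (hsr.pair hok))
  exact ((hcond.ite rdSt hnew).congr fun t => rfl :)

/-! ### The fold of the rounds -/

/-- Along one round the counter grows by at most one, the point keeps its length, and all entries of the
point and the claim stay below `max q 2` (for an input state with these properties). [folklore] -/
theorem natRoundStep_bound (q β d : ℕ) (quants : List Bool) (st : NSt) (yz : List Bool × List Bool)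
    (hv : ∀ x ∈ st.2.1, x < max q 2) (hc : st.2.2.1 < max q 2) :
    (natRoundStep (max q 2) β d quants st yz).1 ≤ st.1 + 1 ∧
      (natRoundStep (max q 2) β d quants st yz).2.1.length = st.2.1.length ∧
      (∀ x ∈ (natRoundStep (max q 2) β d quants st yz).2.1, x < max q 2) ∧
      (natRoundStep (max q 2) β d quants st yz).2.2.1 < max q 2 := by
  have hq : 0 < max q 2 := lt_max_of_lt_right zero_lt_two
  unfold natRoundStep
  split_ifs
  · exact ⟨Nat.le_succ _, rfl, hv, hc⟩
  · refine ⟨le_rfl, List.length_set, fun x hx => ?_, hornerMod_lt hq _ _⟩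
    rcases List.mem_or_eq_of_mem_set hx with h | h
    · exact hv x h
    · rw [h]; exact Nat.mod_lt _ hq

/-- The same along any number of rounds. [folklore] -/
theorem foldl_natRoundStep_bound (q β d : ℕ) (quants : List Bool) :
    ∀ (l : List (List Bool × List Bool)) (st : NSt), (∀ x ∈ st.2.1, x < max q 2) → st.2.2.1 < max q 2 →
      (l.foldl (natRoundStep (max q 2) β d quants) st).1 ≤ st.1 + l.length ∧
        (l.foldl (natRoundStep (max q 2) β d quants) st).2.1.length = st.2.1.length ∧
        (∀ x ∈ (l.foldl (natRoundStep (max q 2) β d quants) st).2.1, x < max q 2) ∧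
        (l.foldl (natRoundStep (max q 2) β d quants) st).2.2.1 < max q 2
  | [], st, hv, hc => ⟨by simp, rfl, hv, hc⟩
  | yz :: l, st, hv, hc => by
    obtain ⟨h1, h2, h3, h4⟩ := natRoundStep_bound q β d quants st yz hv hc
    obtain ⟨k1, k2, k3, k4⟩ := foldl_natRoundStep_bound q β d quants l _ h3 h4
    rw [List.foldl_cons]
    refine ⟨k1.trans ?_, k2.trans h2, k3, k4⟩
    rw [List.length_cons]; omega

/-- **The code of Arthur's state stays quadratic along the rounds** (in the length of the fold's input).
[cite: AroraBarakCC2009, §1.3 (polynomially bounded loops)] -/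
theorem length_stE_foldl_le (s : RCtx) (l₁ l₂ : List (List Bool × List Bool)) :
    (stE (l₁.foldl (fun st yz => natRoundStep (max s.1 2) s.2.2.1 s.2.2.2 s.2.1 st yz) (natInit s.2.1.length))).length ≤
      ((2 * X + 4) ^ 2 : Polynomial ℕ).eval (pairE rctxE (rawE (pairE strE strE)) (s, l₁ ++ l₂)).length := by
  obtain ⟨q, quants, β, d⟩ := s
  set W := (pairE rctxE (rawE (pairE strE strE)) ((q, quants, β, d), l₁ ++ l₂)).length with hW
  have hWexp : W = 2 * (2 * (natE q).length + 2 + (2 * quants.length + 2 + (2 * (unE β).length + 2 + (unE d).length))) + 2 +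
      (rawE (pairE strE strE) (l₁ ++ l₂)).length := by
    simp [hW, pairE]
  rw [length_unE, length_unE] at hWexp
  have hl₁ : l₁.length ≤ W := by
    have := length_le_length_rawE (pairE strE strE) (l₁ ++ l₂)
    rw [List.length_append] at this; omega
  have hqW : (natE q).length + 2 ≤ W := by omega
  have hNW : quants.length ≤ W := by omega
  have hinit_v : ∀ x ∈ (natInit quants.length).2.1, x < max q 2 := fun x hx => by
    simp only [natInit] at hx; rw [List.eq_of_mem_replicate hx]; exact lt_max_of_lt_right zero_lt_two
  have hinit_c : (natInit quants.length).2.2.1 < max q 2 := lt_max_of_lt_right one_lt_two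
  obtain ⟨h1, h2, h3, h4⟩ := foldl_natRoundStep_bound q β d quants l₁ (natInit quants.length) hinit_v hinit_c
  set st := l₁.foldl (natRoundStep (max q 2) β d quants) (natInit quants.length) with hst
  have hlen2 : st.2.1.length = quants.length := by rw [h2]; simp [natInit]
  -- sizes of the components
  have hi : (natE st.1).length ≤ W := by
    refine (length_natE_le _).trans (h1.trans ?_)
    simp only [natInit, zero_add]; exact hl₁
  have hv : (rawE natE st.2.1).length ≤ W * (2 * W + 2) := by
    refine (length_rawE_natE_le_of_lt (hlen2.le.trans hNW) h3).trans (Nat.mul_le_mul_left _ ?_)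
    have := length_natE_max_two_le q; omega
  have hc : (natE st.2.2.1).length ≤ W := (length_natE_le_of_lt_max h4).trans hqW
  have hcode : (stE st).length = 2 * (natE st.1).length + 2 + (2 * (rawE natE st.2.1).length + 2 + (2 * (natE st.2.2.1).length + 2 + 1)) := by
    simp [pairE, bitE]
  change (stE st).length ≤ _
  simp only [eval_pow, eval_add, eval_mul, eval_X, eval_ofNat]
  rw [hcode]
  nlinarith

/-- The initial state `natInit N` from the prefix, on codes. [folklore] -/
theorem natInitC : CodeFP rctxE stE (fun s : RCtx => natInit s.2.1.length) := by
  have hN : CodeFP rctxE unE (fun s : RCtx => s.2.1.length) := (strLength.comp (snd _ _).fst' :)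
  have hrep : CodeFP rctxE (rawE natE) (fun s : RCtx => List.replicate s.2.1.length 0) :=
    ((replicateOf natE).comp ((const _ (0 : ℕ)).pair hN) :)
  exact (((const _ (0 : ℕ)).pair (hrep.pair ((const _ (1 : ℕ)).pair (const _ true)))).congr fun s => rfl :)

/-- **All rounds on codes**: `((q, quants, 1^β, 1^d), pairs) ↦` the state after folding `natRoundStep (max q 2)`
over the move pairs from `natInit N`. [cite: AroraBarakCC2009, §8.3.3 and §1.3 (polynomially bounded loops)] -/
theorem roundsC : CodeFP (pairE rctxE (rawE (pairE strE strE))) stE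
    (fun p => p.2.foldl (fun st yz => natRoundStep (max p.1.1 2) p.1.2.2.1 p.1.2.2.2 p.1.2.1 st yz) (natInit p.1.2.1.length)) :=
  foldl (σ := RCtx) (α := List Bool × List Bool) (β := NSt) (eσ := rctxE) (eα := pairE strE strE) (eβ := stE)
    (step := fun s yz st => natRoundStep (max s.1 2) s.2.2.1 s.2.2.2 s.2.1 st yz) (init := fun s => natInit s.2.1.length)
    natRoundStepC natInitC ((2 * X + 4) ^ 2) length_stE_foldl_le

end ShenRef

end Literature.Computability.Complexity

end
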